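import Mathlib
import Literature.Analysis.FluidPDE.Tao2016AveragedNS.CascadeTableDictionary
import Summits.NavierStokesRegularity.NavierStokesRegularity.Theorems.TaoLadderRungTwoBreakDSSWaveOfOneShiftDatum
import HarnessLib

/-!
# One-shift datum in the tree's SCALAR-FAMILY form (`quadTerm` motion law on one flight) ⟹ admissible
# DSS wave — the bridge from Tao's (4.8)/(4.12) solution notion to `DSSOneShift.isDSSWave_of_oneShiftDatum`
# (cell harvest/h2-tao-ladder, seat p2; support for K1(1) = `NoSurvivingDSSOne`, stmt-NavierStokesRegularity-20205)

MODEL lattice ODEs only (Tao 2016 §4); nothing here is a statement about the Navier–Stokes equations; no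
item is closed.

`DSSOneShift.isDSSWave_of_oneShiftDatum` consumes a shell-VECTOR datum `U : ℤ → ℝ → Em m` solving the
normal form `U_k' = Λ^k (Q(U_k) + Λ⁻¹A(U_{k-1}) + B(U_{k+1}, U_k))`. The tree's flows (`CascadeODESolutionOn`,
`PseudoFlowOnShift`, p1's `WeightedLatticeFlowsOn` existence theory) produce SCALAR families
`X : Fin m → ℤ → ℝ → ℝ` with the motion law `∂ₜ X_{i,k} = quadTerm ε₀ α X i k` ((4.8) without defect).
This module is the bridge: `hasDerivWithinAt_shellVec` (componentwise derivatives ⟹ derivative of the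
shell vector in `Em m`), `bigLam_zpow_eq_rpow` (`(1+ε₀)^{5k/2} = Λ^k`), `shellVec_quadTerm_normalForm`
(the dictionary `CascadeTableDictionary.shellVec_quadTerm` rewritten with `Λ^k` and `Λ⁻¹A`), and the
end result `isDSSWave_of_quadTermDatum`: an exact `quadTerm` solution on the closed flight `[0, τ]`
with the one-shift relation `g X_{i,k+1}(τ) = X_{i,k}(0)`, `Λ = g e^{T}`, and the shell bounds of
`isDSSWave_of_oneShiftDatum` carries an admissible DSS wave (non-trivial, and (S₁)-surviving when
`1 < g² ≤ 1 + ε₀`).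
-/

noncomputable section

-- `Summit.NavierStokesRegularity.NavierStokesRegularity.…` is the tree's (summit = problem) namespace; the
-- duplicated component is intended, so the dupNamespace linter is silenced for this file.
set_option linter.dupNamespace false

namespace Summit.NavierStokesRegularity.NavierStokesRegularity.Theorems

namespace DSSOneShift

open Filter Topology MeasureTheory Set
open Literature.Analysis.FluidPDE Literature.Analysis.FluidPDE.TaoCascade

variable {m : ℕ}

/-- Componentwise one-sided derivatives give the one-sided derivative of the shell vector in `Em m`.
[folklore] -/
theorem hasDerivWithinAt_shellVec {X : Fin m → ℤ → ℝ → ℝ} {X' : Fin m → ℝ} {k : ℤ} {S : Set ℝ}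
    {s : ℝ} (h : ∀ i, HasDerivWithinAt (X i k) (X' i) S s) :
    HasDerivWithinAt (shellVec X k) (WithLp.toLp 2 X') S s := by
  have hpi : HasDerivWithinAt (fun t => fun i => X i k t) X' S s := hasDerivWithinAt_pi.2 h
  have hL := (PiLp.continuousLinearEquiv 2 ℝ (fun _ : Fin m => ℝ)).symm.toContinuousLinearMap.hasFDerivAt
    (x := fun i => X i k s)
  have hcomp := hL.comp_hasDerivWithinAt s hpi
  exact hcomp

/-- `(1+ε₀)^{5k/2} = Λ^k` (`Λ = bigLam ε₀ = (1+ε₀)^{5/2}`, `1 + ε₀ > 0`, `k ∈ ℤ`).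
[cite: Tao2016AveragedNS, §4 (4.1) (the weights `(1+ε₀)^{5n/2}`)] -/
theorem bigLam_zpow_eq_rpow {ε₀ : ℝ} (hε : 0 < 1 + ε₀) (k : ℤ) :
    (1 + ε₀) ^ ((5 : ℝ) * k / 2) = bigLam ε₀ ^ k := by
  unfold bigLam
  rw [← Real.rpow_intCast, ← Real.rpow_mul hε.le]
  congr 1
  ring

/-- The dictionary `shellVec_quadTerm` in NORMAL FORM: the shell vector of the nonlinearity at shell `k` is
`Λ^k • (Q(x_k) + Λ⁻¹ • A(x_{k-1}) + B(x_{k+1}, x_k))`.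
[cite: Tao2016AveragedNS, §4 (4.1) and Lemma 4.1 (4.8)] -/
theorem shellVec_quadTerm_normalForm {ε₀ : ℝ} (hε : 0 < 1 + ε₀)
    (α : Fin m → Fin m → Fin m → ℤ × ℤ × ℤ → ℝ) (X : Fin m → ℤ → ℝ → ℝ) (k : ℤ) (t : ℝ) :
    shellVec (fun i n s => quadTerm ε₀ α X i n s) k t =
      bigLam ε₀ ^ k • (tableQ α (shellVec X k t) + (bigLam ε₀)⁻¹ • tableA α (shellVec X (k - 1) t)
        + tableB α (shellVec X (k + 1) t) (shellVec X k t)) := by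
  rw [shellVec_quadTerm, bigLam_zpow_eq_rpow hε k]
  have h2 : (1 + ε₀) ^ ((5 : ℝ) * ((k : ℝ) - 1) / 2) = bigLam ε₀ ^ k * (bigLam ε₀)⁻¹ := by
    have := bigLam_zpow_eq_rpow hε (k - 1)
    push_cast at this
    rw [this, zpow_sub_one₀ (bigLam_pos (by linarith)).ne']
  rw [h2, smul_add, smul_add, smul_smul]
  abel

/-- **`quadTerm` datum on one flight ⟹ admissible DSS wave.**  Let the scalar family `X` solve Tao's
lattice law exactly on the closed flight, `∂ₜX_{i,k} = quadTerm ε₀ α X i k` on `[0, τ]` (one-sided at the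
ends) for every mode `i` and shell `k`, with the ONE-SHIFT relation `g X_{i,k+1}(τ) = X_{i,k}(0)`,
`Λ = g e^{T}`, `g > 0`, `T > 0`, `τ = t⋆(1 - e^{-T})`, and shell-vector bounds `‖x_{-j}‖ ≤ M_j` on `[0, τ]`
with `Σ_j e^{-jT} g^{-j} M_j < ∞`, `M_n ≤ P gⁿ`. Then the table carries an admissible one-profile DSS wave
with delay `T` (energy ratio `g⁻²`), non-trivial as soon as some `X_{i,0} ≢ 0` on `[0, τ)`.
[cite: Tao2016AveragedNS, §4 Lemma 4.1 (4.8), §5.3–§6; cell vocabulary (`IsDSSWave`), harvest/h2-tao-ladder rung1/STAGE2-LEMMA.md §1–§4] -/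
theorem isDSSWave_of_quadTermDatum {ε₀ : ℝ} {α : Fin m → Fin m → Fin m → ℤ × ℤ × ℤ → ℝ}
    {g T tstar τ P : ℝ} {M : ℤ → ℝ} (hε : 0 < 1 + ε₀) (hg : 0 < g) (hT : 0 < T)
    (hlam : bigLam ε₀ = g * Real.exp T) (hτ : 0 < τ) (htstar : τ = tstar * (1 - Real.exp (-T)))
    {X : Fin m → ℤ → ℝ → ℝ}
    (hX : ∀ (i : Fin m) (k : ℤ) (s : ℝ), s ∈ Icc 0 τ →
      HasDerivWithinAt (X i k) (quadTerm ε₀ α X i k s) (Icc 0 τ) s)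
    (hshift : ∀ (i : Fin m) (k : ℤ), g * X i (k + 1) τ = X i k 0)
    (hM : ∀ (j : ℤ) (s : ℝ), s ∈ Icc 0 τ → ‖shellVec X (-j) s‖ ≤ M j)
    (hsum : Summable fun j : ℤ => Real.exp (-((j : ℝ) * T)) * ((g ^ j)⁻¹ * M j))
    (hP : ∀ n : ℕ, M n ≤ P * g ^ n) :
    ∃ Φ : Unit → ℝ → Em m, IsDSSWave ε₀ α (Equiv.refl Unit) T Φ ∧
      ((∃ s ∈ Ico 0 τ, ∃ i, X i 0 s ≠ 0) → ∃ x, Φ () x ≠ 0) := by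
  -- the shell-vector datum
  have hU : ∀ (k : ℤ) (s : ℝ), s ∈ Icc 0 τ → HasDerivWithinAt (shellVec X k)
      (bigLam ε₀ ^ k • (tableQ α (shellVec X k s) + (bigLam ε₀)⁻¹ • tableA α (shellVec X (k - 1) s)
        + tableB α (shellVec X (k + 1) s) (shellVec X k s))) (Icc 0 τ) s := by
    intro k s hs
    have h := hasDerivWithinAt_shellVec (X' := fun i => quadTerm ε₀ α X i k s) fun i => hX i k s hs
    rw [← shellVec_quadTerm_normalForm hε α X k s]
    exact h
  have hshiftU : ∀ k : ℤ, g • shellVec X (k + 1) τ = shellVec X k 0 := by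
    intro k; ext i; simp [hshift i k]
  obtain ⟨Φ, hΦ, hnt⟩ := isDSSWave_of_oneShiftDatum hg hT hlam hτ htstar hU hshiftU hM hsum hP
  refine ⟨Φ, hΦ, fun ⟨s, hs, i, hi⟩ => hnt ⟨s, hs, fun h0 => hi ?_⟩⟩
  have := congrArg (fun v : Em m => v i) h0
  simpa using this

/-- **… and (S₁)-surviving when `1 < g² ≤ 1 + ε₀`** — the object `NoSurvivingDSSOne` (K1(1),
stmt-NavierStokesRegularity-20205) asserts to be trivial for every `R`-comparable table below its
threshold `ε_s(R)`. [cite: Tao2016AveragedNS, §4 (the viscous equation before Thm. 4.2), §5.3–§6; cell vocabulary (`IsDSSWave`, `Surviving`)] -/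
theorem exists_surviving_dssWave_of_quadTermDatum {ε₀ : ℝ}
    {α : Fin m → Fin m → Fin m → ℤ × ℤ × ℤ → ℝ}
    {g T tstar τ P : ℝ} {M : ℤ → ℝ} (hε : 0 < 1 + ε₀) (hg : 0 < g) (hT : 0 < T)
    (hlam : bigLam ε₀ = g * Real.exp T) (hτ : 0 < τ) (htstar : τ = tstar * (1 - Real.exp (-T)))
    {X : Fin m → ℤ → ℝ → ℝ}
    (hX : ∀ (i : Fin m) (k : ℤ) (s : ℝ), s ∈ Icc 0 τ →
      HasDerivWithinAt (X i k) (quadTerm ε₀ α X i k s) (Icc 0 τ) s)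
    (hshift : ∀ (i : Fin m) (k : ℤ), g * X i (k + 1) τ = X i k 0)
    (hM : ∀ (j : ℤ) (s : ℝ), s ∈ Icc 0 τ → ‖shellVec X (-j) s‖ ≤ M j)
    (hsum : Summable fun j : ℤ => Real.exp (-((j : ℝ) * T)) * ((g ^ j)⁻¹ * M j))
    (hP : ∀ n : ℕ, M n ≤ P * g ^ n)
    (hg1 : 1 < g ^ 2) (hg2 : g ^ 2 ≤ 1 + ε₀) (hne : ∃ s ∈ Ico 0 τ, ∃ i, X i 0 s ≠ 0) :
    ∃ Φ : Unit → ℝ → Em m, IsDSSWave ε₀ α (Equiv.refl Unit) T Φ ∧ Surviving 1 ε₀ T ∧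
      ∃ x, Φ () x ≠ 0 := by
  obtain ⟨Φ, hΦ, hnt⟩ := isDSSWave_of_quadTermDatum hε hg hT hlam hτ htstar hX hshift hM hsum hP
  exact ⟨Φ, hΦ, (surviving_one_iff_of_bigLam_eq hε hg hlam).2 ⟨hg1, hg2⟩, hnt hne⟩

end DSSOneShift

end Summit.NavierStokesRegularity.NavierStokesRegularity.Theorems
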